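import Summits.CriticalPhenomena.PercolationContinuityZ3.Theorems.PercNearOneGluingNoHeavyLowerTailSahiCTCC2ThreeForm
import HarnessLib

/-!
# `NoHeavyLowerTail` (crux stmt-CriticalPhenomena-4575), P3 lane: row 3 of the level-3 monotonicity C2, part 1 — at a profile with EXACTLY THREE
# doubled points (entries `≤ 2`), the C2 difference of `R_3` is at least the four-point functional of `Q = dbl + v` (monotonicity of the Kleitman
# surplus in the free set: all single points can be dropped)

Support file (seat `prim-l12-p3`, gen 43; `--supports stmt-CriticalPhenomena-4575`).  Memo
`run/shared/lean/prim/prim-l12/FROM-prim-l12-p3-g43-C2-LEVEL-THREE.md` §4.  Tools for the reduction of row 3 (exactly three doubled points, entries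
`≤ 2`) of the level-3 monotonicity C2 to the four-point inequality of `…SahiCTCC2ThreeFourPoint` (assembled in `…SahiCTCC2ThreeRowThree`), on top of
the `v`-free Harris form of `…SahiCTCC2ThreeForm`:
* `kap_mono_free` : the Kleitman surplus is monotone in the free set (iterate `…KleitmanSurplus.kap_erase_le`) — so every single point can be dropped;
* the doubled / single sets of the residual profiles `m − 1_b` for `m ≤ 2` (`dbl_tsub_ind_singleton`, `sgl_tsub_ind_of_subset_dbl`, `dbl_tsub_ind_eq_sdiff`,
  `tsub_ind_support_eq_ind_dbl`, …);
* small members of `{#S < 3}`, of its deletion `D⁰` and link `D¹`, and the traces of `D⁰ / D¹` on cubes with many base points (empty or `{∅}`);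
* **`coeff_Pi_delV_mul_le`**, **`coeff_Pi_linkV_mul_le`** : at a `v`-free profile `m ≤ 2` with three doubled points the subtracted block
  `Π'·(GF(D⁰)·GF(W') + GF(D¹)·GF(W))` is at most `#{y doubled : {y} ∈ W'} + #{y doubled : dbl m − y ∈ W}` (the common 2-subsets of `Q = dbl m + v`).
Nothing is asserted about the crux.
-/

noncomputable section

open scoped Classical

namespace Summit.CriticalPhenomena.PercolationContinuityZ3.Theorems.SahiCTCForms

open Finset MvPolynomial SahiCTCGenFun

variable {α : Type*} [DecidableEq α] [Fintype α]

/-! ### Monotonicity of the Kleitman surplus in the free set -/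

omit [Fintype α] in
/-- **`κ` is monotone in the free set** (up-sets): `kap 𝒳 𝒵 D s' ≤ kap 𝒳 𝒵 D s` for `s' ⊆ s` disjoint from `D`. [this work] -/
theorem kap_mono_free {F G : Finset (Finset α)} (hF : IsUpperSet (F : Set (Finset α))) (hG : IsUpperSet (G : Set (Finset α)))
    {D s s' : Finset α} (hDs : Disjoint D s) (h : s' ⊆ s) : kap F G D s' ≤ kap F G D s := by
  -- induction on the finset `s \ s'`
  suffices key : ∀ t : Finset α, Disjoint D (s' ∪ t) → kap F G D s' ≤ kap F G D (s' ∪ t) by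
    have := key (s \ s') (by rw [union_sdiff_of_subset h]; exact hDs)
    rwa [union_sdiff_of_subset h] at this
  intro t
  induction t using Finset.induction_on with
  | empty => intro _; rw [union_empty]
  | insert a t hat ih =>
    intro hdis
    by_cases ha : a ∈ s' ∪ t
    · have : s' ∪ insert a t = s' ∪ t := by
        rw [union_insert]; exact insert_eq_of_mem ha
      rw [this] at hdis ⊢; exact ih hdis
    · have hdis' : Disjoint D (s' ∪ t) := Disjoint.mono_right (union_subset_union Subset.rfl (subset_insert a t)) hdis
      have h1 := ih hdis'
      have h2 := kap_erase_le hF hG hdis (show a ∈ s' ∪ insert a t from mem_union_right _ (mem_insert_self a t))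
      have : (s' ∪ insert a t).erase a = s' ∪ t := by
        rw [union_insert, erase_insert ha]
      rw [this] at h2
      exact h1.trans h2

/-! ### Profiles `≤ 2`: doubled and single sets of residual profiles -/

section Profiles
variable {m : α →₀ ℕ}

omit [DecidableEq α] [Fintype α] in
/-- Membership in the doubled set. [this work] -/
theorem mem_dbl_iff {i : α} : i ∈ dbl m ↔ m i = 2 := by
  unfold dbl; rw [mem_filter, Finsupp.mem_support_iff]; constructor
  · exact fun h => h.2
  · intro h; exact ⟨by omega, h⟩

omit [Fintype α] in
/-- Membership in the single set of a profile `≤ 2`. [this work] -/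
theorem mem_sgl_iff_of_le_two (h2 : ∀ i, m i ≤ 2) {i : α} : i ∈ sgl m ↔ m i = 1 := by
  unfold sgl; rw [mem_sdiff, mem_dbl_iff, Finsupp.mem_support_iff]; have := h2 i; omega

omit [Fintype α] in
/-- Removing one unit at a doubled point `d`: the doubled set loses `d`. [this work] -/
theorem dbl_tsub_ind_singleton {d : α} (hd : m d = 2) : dbl (m - ind {d}) = (dbl m).erase d := by
  ext i
  rw [mem_dbl_iff, mem_erase, mem_dbl_iff, Finsupp.tsub_apply, ind_apply]
  by_cases h : i = d
  · subst h; simp [hd]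
  · simp [h]

omit [Fintype α] in
/-- Removing one unit at a doubled point `d` (profile `≤ 2`): the single set gains `d`. [this work] -/
theorem sgl_tsub_ind_singleton (h2 : ∀ i, m i ≤ 2) {d : α} (hd : m d = 2) : sgl (m - ind {d}) = insert d (sgl m) := by
  have h2' : ∀ i, (m - ind {d}) i ≤ 2 := fun i => by rw [Finsupp.tsub_apply]; exact le_trans (Nat.sub_le _ _) (h2 i)
  ext i
  rw [mem_sgl_iff_of_le_two h2', mem_insert, mem_sgl_iff_of_le_two h2, Finsupp.tsub_apply, ind_apply]
  by_cases h : i = d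
  · subst h; simp [hd]
  · simp only [mem_singleton, h, if_false, tsub_zero, false_or]

omit [Fintype α] in
/-- Removing a set `a` of doubled points (profile `≤ 2`): the doubled set loses `a`. [this work] -/
theorem dbl_tsub_ind_of_subset_dbl {a : Finset α} (ha : a ⊆ dbl m) : dbl (m - ind a) = dbl m \ a := by
  ext i
  rw [mem_dbl_iff, mem_sdiff, mem_dbl_iff, Finsupp.tsub_apply, ind_apply]
  by_cases h : i ∈ a
  · have := mem_dbl_iff.1 (ha h); simp [h, this]
  · simp [h]

omit [Fintype α] in
/-- Removing a set `a` of doubled points (profile `≤ 2`): the single set gains `a`. [this work] -/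
theorem sgl_tsub_ind_of_subset_dbl (h2 : ∀ i, m i ≤ 2) {a : Finset α} (ha : a ⊆ dbl m) : sgl (m - ind a) = sgl m ∪ a := by
  have h2' : ∀ i, (m - ind a) i ≤ 2 := fun i => by rw [Finsupp.tsub_apply]; exact le_trans (Nat.sub_le _ _) (h2 i)
  ext i
  rw [mem_sgl_iff_of_le_two h2', mem_union, mem_sgl_iff_of_le_two h2, Finsupp.tsub_apply, ind_apply]
  by_cases h : i ∈ a
  · have := mem_dbl_iff.1 (ha h); simp [h, this]
  · simp [h]

omit [Fintype α] in
/-- Removing an arbitrary set `b` from a profile `≤ 2`: the doubled set loses `b`. [this work] -/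
theorem dbl_tsub_ind_eq_sdiff (h2 : ∀ i, m i ≤ 2) (b : Finset α) : dbl (m - ind b) = dbl m \ b := by
  ext i
  rw [mem_dbl_iff, mem_sdiff, mem_dbl_iff, Finsupp.tsub_apply, ind_apply]
  have := h2 i
  by_cases h : i ∈ b
  · simp only [h, if_true, not_true_eq_false, and_false, iff_false]; omega
  · simp [h]

omit [Fintype α] in
/-- For a profile `≤ 2`, `m = 1_{supp m} + 1_{dbl m}`, i.e. `m − 1_{supp m} = 1_{dbl m}`. [this work] -/
theorem tsub_ind_support_eq_ind_dbl (h2 : ∀ i, m i ≤ 2) : m - ind m.support = ind (dbl m) := by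
  ext i
  have hi := h2 i
  have e1 : ind m.support i = if m i ≠ 0 then 1 else 0 := by
    rw [ind_apply]; by_cases h : m i ≠ 0 <;> simp [h, Finsupp.mem_support_iff]
  have e2 : ind (dbl m) i = if m i = 2 then 1 else 0 := by
    rw [ind_apply]; by_cases h : m i = 2 <;> simp [h, mem_dbl_iff]
  rw [Finsupp.tsub_apply, e1, e2]
  by_cases h0 : m i = 0
  · simp [h0]
  · rw [if_pos h0]; by_cases h2i : m i = 2
    · simp [h2i]
    · rw [if_neg h2i]; omega

omit [Fintype α] in
/-- `1_{supp m} ≤ m`. [this work] -/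
theorem ind_support_le (m : α →₀ ℕ) : ind m.support ≤ m := fun i => by
  have e1 : ind m.support i = if m i ≠ 0 then 1 else 0 := by
    rw [ind_apply]; by_cases h : m i ≠ 0 <;> simp [h, Finsupp.mem_support_iff]
  rw [e1]; split_ifs with h <;> omega

end Profiles

/-! ### Small members of `{#S < 3}` and of its deletion / link -/

section SmallSets
variable {v : α}

/-- A `v`-free set of size `≤ 2` lies in the deletion of `{#S < 3}`. [this work] -/
theorem mem_delV_bySize_of_card {S : Finset α} (hv : v ∉ S) (hS : #S ≤ 2) : S ∈ delV v (bySize (· < 3) : Finset (Finset α)) :=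
  mem_filter.2 ⟨(mem_bySize_iff _ _).2 (by omega), hv⟩

/-- A `v`-free set of size `≤ 1` lies in the link of `{#S < 3}`. [this work] -/
theorem mem_linkV_bySize_of_card {S : Finset α} (hv : v ∉ S) (hS : #S ≤ 1) : S ∈ linkV v (bySize (· < 3) : Finset (Finset α)) := by
  refine mem_filter.2 ⟨mem_powerset.2 (subset_erase.2 ⟨subset_univ _, hv⟩), (mem_bySize_iff _ _).2 ?_⟩
  rw [card_insert_of_notMem hv]; omega

/-- A `v`-free 2-set lies in `D⁰ ∖ D¹` for `D = {#S < 3}`. [this work] -/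
theorem mem_delV_sdiff_linkV_of_card_two {S : Finset α} (hv : v ∉ S) (hS : #S = 2) :
    S ∈ delV v (bySize (· < 3) : Finset (Finset α)) \ linkV v (bySize (· < 3) : Finset (Finset α)) := by
  refine mem_sdiff.2 ⟨mem_delV_bySize_of_card hv (by omega), fun h => ?_⟩
  have := (mem_bySize_iff _ _).1 (mem_filter.1 h).2
  rw [card_insert_of_notMem hv] at this; omega

/-- For a `v`-free set `S` of size `≤ 2`: `S ∈ delV v (K ∩ {#<3})` iff `S ∈ K`. [this work] -/
theorem mem_delV_filter_bySize_iff {K : Finset (Finset α)} {S : Finset α} (hv : v ∉ S) (hS : #S ≤ 2) :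
    S ∈ delV v (K.filter fun T => T ∈ (bySize (· < 3) : Finset (Finset α))) ↔ S ∈ K := by
  unfold delV; rw [mem_filter, mem_filter, mem_bySize_iff]
  exact ⟨fun h => h.1.1, fun h => ⟨⟨h, by omega⟩, hv⟩⟩

/-- For a `v`-free set `S` of size `≤ 1`: `S ∈ linkV v (K ∩ {#<3})` iff `S + v ∈ K`. [this work] -/
theorem mem_linkV_filter_bySize_iff {K : Finset (Finset α)} {S : Finset α} (hv : v ∉ S) (hS : #S ≤ 1) :
    S ∈ linkV v (K.filter fun T => T ∈ (bySize (· < 3) : Finset (Finset α))) ↔ insert v S ∈ K := by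
  unfold linkV; rw [mem_filter, mem_filter, mem_bySize_iff, mem_powerset, card_insert_of_notMem hv]
  exact ⟨fun h => h.2.1, fun h => ⟨subset_erase.2 ⟨subset_univ _, hv⟩, h, by omega⟩⟩

/-- The trace of `D⁰` (sets of size `≤ 2`) on a cube with `≥ 3` base points is empty. [this work] -/
theorem tr_delV_bySize_eq_empty {D s : Finset α} (hD : 3 ≤ #D) : tr (delV v (bySize (· < 3) : Finset (Finset α))) D s = ∅ := by
  refine filter_eq_empty_iff.2 fun U _ h => ?_
  have := (mem_bySize_iff _ _).1 (mem_filter.1 h).1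
  have := card_le_card (subset_union_left (s₁ := D) (s₂ := U)); omega

/-- The trace of `D⁰` on a cube with `≥ 2` base points has at most one member (the empty set). [this work] -/
theorem card_tr_delV_bySize_le_one {D s : Finset α} (hDs : Disjoint D s) (hD : 2 ≤ #D) :
    #(tr (delV v (bySize (· < 3) : Finset (Finset α))) D s) ≤ 1 := by
  refine card_le_one.2 fun U hU U' hU' => ?_
  have hmem : ∀ W ∈ tr (delV v (bySize (· < 3) : Finset (Finset α))) D s, W = ∅ := by
    intro W hW
    obtain ⟨hWs, hW⟩ := mem_tr.1 hW
    have h3 := (mem_bySize_iff _ _).1 (mem_filter.1 hW).1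
    rw [card_union_of_disjoint (hDs.mono_right hWs)] at h3
    exact card_eq_zero.1 (by omega)
  rw [hmem U hU, hmem U' hU']

/-- The trace of `D¹` (sets of size `≤ 1`) on a cube with `≥ 2` base points is empty. [this work] -/
theorem tr_linkV_bySize_eq_empty {D s : Finset α} (hD : 2 ≤ #D) : tr (linkV v (bySize (· < 3) : Finset (Finset α))) D s = ∅ := by
  refine filter_eq_empty_iff.2 fun U _ h => ?_
  obtain ⟨hP, hB⟩ := mem_filter.1 h
  have hv : v ∉ D ∪ U := (subset_erase.1 (mem_powerset.1 hP)).2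
  have := (mem_bySize_iff _ _).1 hB
  rw [card_insert_of_notMem hv] at this
  have := card_le_card (subset_union_left (s₁ := D) (s₂ := U)); omega

/-- The trace of `D¹` on a cube with `≥ 1` base point has at most one member. [this work] -/
theorem card_tr_linkV_bySize_le_one {D s : Finset α} (hDs : Disjoint D s) (hD : 1 ≤ #D) :
    #(tr (linkV v (bySize (· < 3) : Finset (Finset α))) D s) ≤ 1 := by
  refine card_le_one.2 fun U hU U' hU' => ?_
  have hmem : ∀ W ∈ tr (linkV v (bySize (· < 3) : Finset (Finset α))) D s, W = ∅ := by
    intro W hW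
    obtain ⟨hWs, hW⟩ := mem_tr.1 hW
    obtain ⟨hP, hB⟩ := mem_filter.1 hW
    have hv : v ∉ D ∪ W := (subset_erase.1 (mem_powerset.1 hP)).2
    have h3 := (mem_bySize_iff _ _).1 hB
    rw [card_insert_of_notMem hv, card_union_of_disjoint (hDs.mono_right hWs)] at h3
    exact card_eq_zero.1 (by omega)
  rw [hmem U hU, hmem U' hU']

end SmallSets

/-! ### The subtracted block is at most the number of common 2-subsets of `Q` -/

section SmallBlock
variable {v : α} {m : α →₀ ℕ}

/-- **`Π'·GF(D⁰)·GF(W')` at a `v`-free profile `m ≤ 2` with three doubled points**, for a family `W'` of sets of size `≤ 1`, is at most the number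
of doubled points `y` with `{y} ∈ W'`. [this work] -/
theorem coeff_Pi_delV_mul_le {W' : Finset (Finset α)} (hW' : ∀ b ∈ W', #b ≤ 1) (hv : m v = 0) (h2 : ∀ i, m i ≤ 2) (h3 : #(dbl m) = 3) :
    (gf (delV v (univ.powerset : Finset (Finset α))) * (gf (delV v (bySize (· < 3) : Finset (Finset α))) * gf W')).coeff m
      ≤ #((dbl m).filter fun y => ({y} : Finset α) ∈ W') := by
  rw [show gf (delV v (univ.powerset : Finset (Finset α))) * (gf (delV v (bySize (· < 3) : Finset (Finset α))) * gf W')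
      = gf W' * (gf (delV v (univ.powerset : Finset (Finset α))) * gf (delV v (bySize (· < 3) : Finset (Finset α)))) by ring,
    coeff_gf_mul]
  -- each summand is `#tr D⁰ (dbl m ∖ b) (…) ≤ [b = {y}, y doubled]`
  have hterm : ∀ b ∈ W'.filter (fun b => ind b ≤ m),
      (gf (delV v (univ.powerset : Finset (Finset α))) * gf (delV v (bySize (· < 3) : Finset (Finset α)))).coeff (m - ind b)
        ≤ if ∃ y ∈ dbl m, b = {y} then (1 : ℤ) else 0 := by
    intro b hb
    have hb1 : #b ≤ 1 := hW' b (mem_filter.1 hb).1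
    have hn : ∀ i, (m - ind b) i ≤ 2 := fun i => by rw [Finsupp.tsub_apply]; exact le_trans (Nat.sub_le _ _) (h2 i)
    have hnv : (m - ind b) v = 0 := by rw [Finsupp.tsub_apply, hv]; omega
    have hdis : Disjoint (dbl m \ b) (sgl (m - ind b)) := by
      have := disjoint_dbl_sgl (m - ind b); rwa [dbl_tsub_ind_eq_sdiff h2 b] at this
    rw [coeff_delVpow_mul_gf _ hnv, coeff_PiP_mul_gf_eq_card_tr _ hn, dbl_tsub_ind_eq_sdiff h2 b]
    split_ifs with hy
    · obtain ⟨y, hy, rfl⟩ := hy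
      have hc : #(dbl m \ {y}) = 2 := by rw [sdiff_singleton_eq_erase, card_erase_of_mem hy, h3]
      exact_mod_cast card_tr_delV_bySize_le_one hdis (by omega)
    · -- `b` is empty or a singleton outside `dbl m`, so `dbl m ∖ b = dbl m` has three points
      have hsd : dbl m \ b = dbl m := by
        refine sdiff_eq_self_of_disjoint (disjoint_left.2 fun y hyd hyb => hy ⟨y, hyd, ?_⟩)
        exact (eq_of_subset_of_card_le (singleton_subset_iff.2 hyb) (by rw [card_singleton]; exact hb1)).symm
      rw [hsd, tr_delV_bySize_eq_empty (by omega), card_empty]; exact_mod_cast le_rfl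
  refine (sum_le_sum hterm).trans ?_
  rw [← sum_filter, sum_const, nsmul_eq_mul, mul_one]
  -- the `b`'s with `b = {y}`, `y` doubled, inject into the doubled points `y` with `{y} ∈ W'`
  have hsub : (W'.filter (fun b => ind b ≤ m)).filter (fun b => ∃ y ∈ dbl m, b = {y})
      ⊆ ((dbl m).filter fun y => ({y} : Finset α) ∈ W').image fun y => ({y} : Finset α) := by
    intro b hb
    obtain ⟨hb', y, hy, rfl⟩ := mem_filter.1 hb
    exact mem_image.2 ⟨y, mem_filter.2 ⟨hy, (mem_filter.1 hb').1⟩, rfl⟩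
  exact_mod_cast (card_le_card hsub).trans card_image_le

/-- **`Π'·GF(D¹)·GF(W)` at a `v`-free profile `m ≤ 2` with three doubled points**, for a family `W` of sets of size `≤ 2`, is at most the number of
doubled points `y` with `dbl m − y ∈ W`. [this work] -/
theorem coeff_Pi_linkV_mul_le {W : Finset (Finset α)} (hW : ∀ b ∈ W, #b ≤ 2) (hv : m v = 0) (h2 : ∀ i, m i ≤ 2) (h3 : #(dbl m) = 3) :
    (gf (delV v (univ.powerset : Finset (Finset α))) * (gf (linkV v (bySize (· < 3) : Finset (Finset α))) * gf W)).coeff m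
      ≤ #((dbl m).filter fun y => (dbl m).erase y ∈ W) := by
  rw [show gf (delV v (univ.powerset : Finset (Finset α))) * (gf (linkV v (bySize (· < 3) : Finset (Finset α))) * gf W)
      = gf W * (gf (delV v (univ.powerset : Finset (Finset α))) * gf (linkV v (bySize (· < 3) : Finset (Finset α)))) by ring,
    coeff_gf_mul]
  have hterm : ∀ b ∈ W.filter (fun b => ind b ≤ m),
      (gf (delV v (univ.powerset : Finset (Finset α))) * gf (linkV v (bySize (· < 3) : Finset (Finset α)))).coeff (m - ind b)
        ≤ if b ⊆ dbl m ∧ #b = 2 then (1 : ℤ) else 0 := by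
    intro b hb
    have hb2 : #b ≤ 2 := hW b (mem_filter.1 hb).1
    have hn : ∀ i, (m - ind b) i ≤ 2 := fun i => by rw [Finsupp.tsub_apply]; exact le_trans (Nat.sub_le _ _) (h2 i)
    have hnv : (m - ind b) v = 0 := by rw [Finsupp.tsub_apply, hv]; omega
    have hdis : Disjoint (dbl m \ b) (sgl (m - ind b)) := by
      have := disjoint_dbl_sgl (m - ind b); rwa [dbl_tsub_ind_eq_sdiff h2 b] at this
    rw [coeff_delVpow_mul_gf _ hnv, coeff_PiP_mul_gf_eq_card_tr _ hn, dbl_tsub_ind_eq_sdiff h2 b]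
    have hcard : #(dbl m \ b) + #(dbl m ∩ b) = 3 := by rw [card_sdiff_add_card_inter, h3]
    have hint : #(dbl m ∩ b) ≤ #b := card_le_card inter_subset_right
    split_ifs with hy
    · exact_mod_cast card_tr_linkV_bySize_le_one hdis (by omega)
    · -- `#(dbl m ∩ b) ≤ 1` (else `b ⊆ dbl m` with `#b = 2`), so `dbl m ∖ b` has ≥ 2 points
      have hge : 2 ≤ #(dbl m \ b) := by
        by_contra hlt
        have h2' : #(dbl m ∩ b) = 2 := by omega
        have hbeq : dbl m ∩ b = b := eq_of_subset_of_card_le inter_subset_right (by omega)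
        exact hy ⟨by rw [← hbeq]; exact inter_subset_left, by rw [← hbeq, h2']⟩
      rw [tr_linkV_bySize_eq_empty hge, card_empty]; exact_mod_cast le_rfl
  refine (sum_le_sum hterm).trans ?_
  rw [← sum_filter, sum_const, nsmul_eq_mul, mul_one]
  -- the `b ⊆ dbl m` with `#b = 2` are the `dbl m − y`
  have hsub : (W.filter (fun b => ind b ≤ m)).filter (fun b => b ⊆ dbl m ∧ #b = 2)
      ⊆ ((dbl m).filter fun y => (dbl m).erase y ∈ W).image fun y => (dbl m).erase y := by
    intro b hb
    obtain ⟨hb', hbd, hb2⟩ := mem_filter.1 hb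
    have hc : #(dbl m \ b) = 1 := by have := card_sdiff_of_subset hbd; omega
    obtain ⟨y, hy⟩ := card_eq_one.1 hc
    have hyd : y ∈ dbl m := (mem_sdiff.1 (hy ▸ mem_singleton_self y)).1
    have hbe : b = (dbl m).erase y := by rw [← sdiff_singleton_eq_erase, ← hy, Finset.sdiff_sdiff_eq_self hbd]
    refine mem_image.2 ⟨y, mem_filter.2 ⟨hyd, ?_⟩, hbe.symm⟩
    rw [← hbe]; exact (mem_filter.1 hb').1
  exact_mod_cast (card_le_card hsub).trans card_image_le

end SmallBlock

end Summit.CriticalPhenomena.PercolationContinuityZ3.Theorems.SahiCTCForms
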